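import Literature.Probability.RandomPlanarGeometry.CritPercSLEDimensionFinal
import Literature.Probability.RandomPlanarGeometry.SLEOnePointSharpUpper
import HarnessLib

/-!
# Beffara's dimension theorem from his printed second-moment estimate (and the SLE₈ trace theorem)

Topic `Probability/RandomPlanarGeometry`; theorems only. The assembled form of Beffara's theorem in the
tree, `ae_dimH_range_sleTrace_of_hasSLETrace_eight_of_twoPoint` (`CritPercSLEDimensionFinal.lean`),
asks for the two-point estimate in the shape of condition 3 of Beffara's Prop. 1 on EVERY compact
`K ⊆ ℍ`: `P(dist(x, γ) ≤ ε, dist(y, γ) ≤ ε) ≤ c₃ ε^{2s} |x - y|^{-s}` for all `x, y ∈ K`, `0 < ε ≤ ε₀`,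
`s = 1 - κ/8`. What V. Beffara, *The dimension of the SLE curves*, Ann. Probab. 36 (2008), §3 actually
prints is narrower: for two points `z, z'` with `δ = |z - z'|/2`, "both `Im z` and `Im z'` greater than
`18δ`" (§3.1) and "`ε < |z' - z|/2`" (§3), in a fixed window, `P(E_ε(z, z')) ≤ C a^{-2s} ε^{2s} δ^{-s}`
(last display of §3.2). This file closes the gap between the two shapes, so that the dimension fact
`Literature.Probability.RandomPlanarGeometry.ae_dimH_range_sleTrace` is reduced, for `κ < 8`, to the
printed second-moment estimate **verbatim** (hypothesis `h2` below, quantified exactly as printed with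
the window normalisation `Im ≥ 1`), and at `κ = 8` to `hasSLETrace_eight` (to which it is equivalent
there, `ae_dimH_range_sleTrace_eight_iff_hasSLETrace_eight`):

* `twoPoint_window_of_secondMoment` — condition 3 on the window `B̄(20i, 1)` (where every pair of
  points satisfies Beffara's standing assumptions: `Im ≥ 19 > 9|x - y|`) from the printed estimate for
  pairs at distance `> 2ε` and from the **sharp** one-point estimate
  `measure_infDist_sleTrace_le_critical` (`SLEOnePointSharpUpper.lean`) for pairs at distance `≤ 2ε`
  (where `|x - y|^{-s} ≥ (2ε)^{-s}` pays for the missing factor `ε^s`; the sub-critical one-point bound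
  would not suffice here);
* `ae_dimH_range_sleTrace_eq_of_lt_eight_of_secondMoment` — `dim_H γ[0,∞) = 1 + κ/8` a.s. for
  `0 < κ < 8` from `h2` alone (second-moment method in the window `B̄(20i, 1)`,
  `measure_dimH_range_sleTrace_ge_pos_of_estimates`; one-point lower bound
  `exists_onePoint_lower_of_isCompact`; upper bound, 0–1 law, trace and transience from the tree);
* `ae_dimH_range_sleTrace_of_hasSLETrace_eight_of_secondMoment` — the fact for all `0 < κ ≤ 8` from
  `hasSLETrace_eight` and the printed second-moment estimate.

The estimate `h2` itself (Beffara (2008), §3; independently Lawler–Werness, Ann. Probab. 41 (2013),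
§4 Thm. 2 "Beffara's estimate", arXiv:1011.3551) is not proved in the tree: both printed proofs use
Beurling's estimate, extremal distance / excursion measure and the topology of separating crosscuts.

## References

* V. Beffara, *The dimension of the SLE curves*, Ann. Probab. 36 (2008): Prop. 1, §3.1, §3.2 (last
  display), Theorem (Introduction). [Beffara2008]
* G. F. Lawler, B. M. Werness, *Multi-point Green's functions for SLE and an estimate of Beffara*,
  Ann. Probab. 41 (2013) 1513–1555, §4 Thm. 2. [LawlerWerness2010]
* G. F. Lawler, O. Schramm, W. Werner, *Conformal invariance of planar loop-erased random walks and
  uniform spanning trees*, Ann. Probab. 32 (2004), Thm. 4.7. [LawlerSchrammWerner2004]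
-/

noncomputable section

open Set Filter Topology MeasureTheory Metric Complex
open UpperHalfPlane (upperHalfPlaneSet isOpen_upperHalfPlaneSet)
open Literature.MeasureTheory.Hausdorff
open scoped NNReal ENNReal

namespace Literature.Probability.RandomPlanarGeometry

open Loewner Literature.Probability.Process

variable {κ : ℝ≥0}

/-! ### The window `B̄(20i, 1)` -/

/-- The window `B̄(20i, 1)` is compact, lies in `ℍ`, and has positive area. [folklore] -/
theorem window20_props :
    IsCompact (closedBall (20 * I) 1) ∧ closedBall (20 * I) 1 ⊆ upperHalfPlaneSet ∧
      volume (closedBall (20 * I : ℂ) 1) ≠ 0 := by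
  refine ⟨isCompact_closedBall _ _, fun z hz ↦ ?_, (measure_closedBall_pos volume _ one_pos).ne'⟩
  rw [mem_closedBall, dist_eq_norm] at hz
  have him : |(z - 20 * I).im| ≤ 1 := (abs_im_le_norm _).trans hz
  have h2 : (z - 20 * I).im = z.im - 20 := by simp
  rw [h2, abs_le] at him
  show 0 < z.im
  linarith [him.1]

/-- Points of the window have imaginary part at least `19`. [folklore] -/
theorem im_ge_of_mem_window20 {z : ℂ} (hz : z ∈ closedBall (20 * I) 1) : 19 ≤ z.im := by
  rw [mem_closedBall, dist_eq_norm] at hz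
  have him : |(z - 20 * I).im| ≤ 1 := (abs_im_le_norm _).trans hz
  have h2 : (z - 20 * I).im = z.im - 20 := by simp
  rw [h2, abs_le] at him
  linarith [him.1]

/-- Two points of the window are at distance at most `2`. [folklore] -/
theorem norm_sub_le_of_mem_window20 {x y : ℂ} (hx : x ∈ closedBall (20 * I) 1)
    (hy : y ∈ closedBall (20 * I) 1) : ‖x - y‖ ≤ 2 := by
  rw [mem_closedBall, dist_eq_norm] at hx hy
  calc ‖x - y‖ = ‖(x - 20 * I) - (y - 20 * I)‖ := by ring_nf
    _ ≤ ‖x - 20 * I‖ + ‖y - 20 * I‖ := norm_sub_le _ _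
    _ ≤ 2 := by linarith

/-! ### The Riesz kernel at positive distance -/

/-- For `x ≠ y`, `k_s(x, y) = ofReal (|x - y|^{-s})`. [folklore] -/
theorem rieszKernel_eq_ofReal_rpow_neg {x y : ℂ} (hxy : x ≠ y) {s : ℝ} (hs : 0 ≤ s) :
    rieszKernel s x y = ENNReal.ofReal (‖x - y‖ ^ (-s)) := by
  have hd : 0 < ‖x - y‖ := norm_pos_iff.2 (sub_ne_zero.2 hxy)
  rw [rieszKernel_apply, edist_dist, dist_eq_norm, ← ENNReal.ofReal_inv_of_pos hd,
    ENNReal.ofReal_rpow_of_nonneg (inv_nonneg.2 hd.le) hs, Real.inv_rpow hd.le, Real.rpow_neg hd.le]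

/-- On the diagonal the Riesz kernel is `∞` (`s > 0`). [folklore] -/
theorem rieszKernel_self_eq_top (x : ℂ) {s : ℝ} (hs : 0 < s) : rieszKernel s x x = ⊤ := by
  rw [rieszKernel_apply, edist_self, ENNReal.inv_zero, ENNReal.top_rpow_of_pos hs]

/-! ### Condition 3 on the window from the printed second-moment estimate -/

/-- **Condition 3 of Beffara's Prop. 1 on the window `B̄(20i, 1)`** from the printed second-moment
estimate `h2` (pairs `z, z'` with `Im ≥ 1`, `Im > 9|z - z'|`, `0 < ε < |z - z'|/2`) and the sharp
one-point estimate (pairs at distance `≤ 2ε`): there are `c₃ < ∞` and `ε₀ > 0` with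
`P(dist(x, γ) ≤ ε, dist(y, γ) ≤ ε) ≤ c₃ ε^{2s} k_s(x, y)` for all `x, y` in the window and `0 < ε ≤ ε₀`,
`s = 1 - κ/8`. [cite: Beffara2008, Prop. 1 (3) and §3.2] -/
theorem twoPoint_window_of_secondMoment (hκ0 : 0 < κ) (hκ8 : κ < 8) (hT : HasSLETrace κ)
    (h2 : ∃ C : ℝ≥0, ∀ z z' : ℂ, 1 ≤ z.im → 1 ≤ z'.im → 9 * ‖z - z'‖ < z.im → 9 * ‖z - z'‖ < z'.im →
      ∀ ε : ℝ, 0 < ε → ε < ‖z - z'‖ / 2 →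
        preWienerMeasure {ω | infDist z (range (sleTrace κ ω)) ≤ ε ∧
            infDist z' (range (sleTrace κ ω)) ≤ ε} ≤
          C * ENNReal.ofReal (ε ^ (2 * (1 - (κ : ℝ) / 8)) * (‖z - z'‖ / 2) ^ (-(1 - (κ : ℝ) / 8)))) :
    ∃ c₃ : ℝ≥0∞, c₃ ≠ ⊤ ∧ ∃ ε₀ : ℝ, 0 < ε₀ ∧ ∀ ε : ℝ, 0 < ε → ε ≤ ε₀ →
      ∀ x ∈ closedBall (20 * I) 1, ∀ y ∈ closedBall (20 * I) 1,
        preWienerMeasure {ω | infDist x (range (sleTrace κ ω)) ≤ ε ∧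
            infDist y (range (sleTrace κ ω)) ≤ ε} ≤
          c₃ * ENNReal.ofReal (ε ^ (1 - (κ : ℝ) / 8)) ^ 2 * rieszKernel (1 - (κ : ℝ) / 8) x y := by
  obtain ⟨C, hC⟩ := h2
  obtain ⟨C₁, hC₁⟩ := measure_infDist_sleTrace_le_critical hκ0 hκ8 hT
  set s : ℝ := 1 - (κ : ℝ) / 8 with hs
  have hκ8' : (κ : ℝ) < 8 := by exact_mod_cast hκ8
  have hs0 : 0 < s := by rw [hs]; linarith
  -- the constant
  set c₃ : ℝ≥0∞ := ((max C₁ C : ℝ≥0) + 1 : ℝ≥0∞) * ENNReal.ofReal ((2 : ℝ) ^ s) with hc₃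
  have hc₃top : c₃ ≠ ⊤ := ENNReal.mul_ne_top (by simp) ENNReal.ofReal_ne_top
  have h2s : 0 < (2 : ℝ) ^ s := Real.rpow_pos_of_pos two_pos _
  have hc₃0 : c₃ ≠ 0 := mul_ne_zero (by simp) (by simpa [ENNReal.ofReal_eq_zero, not_le] using h2s)
  refine ⟨c₃, hc₃top, 1, one_pos, fun ε hε _ x hx y hy ↦ ?_⟩
  have hxim := im_ge_of_mem_window20 hx
  have hyim := im_ge_of_mem_window20 hy
  have hxy2 := norm_sub_le_of_mem_window20 hx hy
  have hεs : 0 < ε ^ s := Real.rpow_pos_of_pos hε _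
  set A : Set (ℝ≥0 → ℝ) := {ω | infDist x (range (sleTrace κ ω)) ≤ ε ∧
      infDist y (range (sleTrace κ ω)) ≤ ε} with hA
  rcases eq_or_ne x y with rfl | hxy
  · -- diagonal: the right-hand side is `∞`
    rw [rieszKernel_self_eq_top x hs0, ENNReal.mul_top]
    · exact le_top
    · exact mul_ne_zero hc₃0 (pow_ne_zero _ (by simpa [ENNReal.ofReal_eq_zero, not_le] using hεs))
  have hd : 0 < ‖x - y‖ := norm_pos_iff.2 (sub_ne_zero.2 hxy)
  rw [rieszKernel_eq_ofReal_rpow_neg hxy hs0.le]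
  -- `c₃ ≥ (max C₁ C) * 2^s` in the two useful forms
  have hCle : (C : ℝ≥0∞) * ENNReal.ofReal ((2 : ℝ) ^ s) ≤ c₃ := by
    rw [hc₃]
    gcongr
    exact le_add_right (by exact_mod_cast le_max_right C₁ C)
  have hC₁le : (C₁ : ℝ≥0∞) ≤ c₃ * ENNReal.ofReal ((2 : ℝ) ^ (-s)) := by
    rw [hc₃, mul_assoc, ← ENNReal.ofReal_mul h2s.le, ← Real.rpow_add two_pos, add_neg_cancel,
      Real.rpow_zero, ENNReal.ofReal_one, mul_one]
    exact le_add_right (by exact_mod_cast le_max_left C₁ C)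
  rcases le_or_gt ‖x - y‖ (2 * ε) with hnear | hfar
  · -- pairs at distance `≤ 2ε`: the sharp one-point estimate at `x`
    have hxim0 : 0 < x.im := by linarith
    calc preWienerMeasure A ≤ preWienerMeasure {ω | infDist x (range (sleTrace κ ω)) ≤ ε} :=
          measure_mono fun ω hω ↦ hω.1
      _ ≤ C₁ * ENNReal.ofReal ((ε / x.im) ^ s) := hC₁ hxim0 hε
      _ ≤ C₁ * ENNReal.ofReal (ε ^ s) := by
          gcongr
          exact div_le_self hε.le (by linarith)
      _ ≤ c₃ * ENNReal.ofReal ((2 : ℝ) ^ (-s)) * ENNReal.ofReal (ε ^ s) := by gcongr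
      _ ≤ c₃ * ENNReal.ofReal (ε ^ s) ^ 2 * ENNReal.ofReal (‖x - y‖ ^ (-s)) := by
          -- `2^{-s} ε^s ≤ ε^{2s} |x-y|^{-s}` since `|x-y| ≤ 2ε`
          have hkey : (2 : ℝ) ^ (-s) * ε ^ s ≤ ε ^ s * ε ^ s * ‖x - y‖ ^ (-s) := by
            have h1 : ‖x - y‖ ^ (-s) ≥ (2 * ε) ^ (-s) :=
              Real.rpow_le_rpow_of_nonpos hd hnear (by linarith)
            have h2 : (2 * ε) ^ (-s) = (2 : ℝ) ^ (-s) * (ε ^ s)⁻¹ := by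
              rw [Real.mul_rpow two_pos.le hε.le, Real.rpow_neg hε.le]
            calc (2 : ℝ) ^ (-s) * ε ^ s = ε ^ s * ε ^ s * ((2 : ℝ) ^ (-s) * (ε ^ s)⁻¹) := by
                  field_simp
              _ ≤ ε ^ s * ε ^ s * ‖x - y‖ ^ (-s) := by
                  rw [← h2]
                  exact mul_le_mul_of_nonneg_left h1 (by positivity)
          calc c₃ * ENNReal.ofReal ((2 : ℝ) ^ (-s)) * ENNReal.ofReal (ε ^ s)
                = c₃ * ENNReal.ofReal ((2 : ℝ) ^ (-s) * ε ^ s) := by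
                  rw [mul_assoc, ← ENNReal.ofReal_mul (Real.rpow_nonneg two_pos.le _)]
            _ ≤ c₃ * ENNReal.ofReal (ε ^ s * ε ^ s * ‖x - y‖ ^ (-s)) := by
                  gcongr
            _ = c₃ * ENNReal.ofReal (ε ^ s) ^ 2 * ENNReal.ofReal (‖x - y‖ ^ (-s)) := by
                  rw [ENNReal.ofReal_mul (by positivity), ENNReal.ofReal_mul hεs.le, sq]
                  ring
  · -- pairs at distance `> 2ε`: the printed second-moment estimate
    have h9x : 9 * ‖x - y‖ < x.im := by linarith
    have h9y : 9 * ‖x - y‖ < y.im := by linarith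
    have hε2 : ε < ‖x - y‖ / 2 := by linarith
    calc preWienerMeasure A
        ≤ C * ENNReal.ofReal (ε ^ (2 * s) * (‖x - y‖ / 2) ^ (-s)) :=
          hC x y (by linarith) (by linarith) h9x h9y ε hε hε2
      _ = C * ENNReal.ofReal ((2 : ℝ) ^ s) * (ENNReal.ofReal (ε ^ s) ^ 2 *
            ENNReal.ofReal (‖x - y‖ ^ (-s))) := by
          have hsplit : ε ^ (2 * s) * (‖x - y‖ / 2) ^ (-s) =
              (2 : ℝ) ^ s * (ε ^ s * ε ^ s * ‖x - y‖ ^ (-s)) := by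
            rw [Real.div_rpow hd.le two_pos.le, Real.rpow_neg two_pos.le, two_mul,
              Real.rpow_add hε]
            field_simp
          rw [hsplit, ENNReal.ofReal_mul (Real.rpow_nonneg two_pos.le _),
            ENNReal.ofReal_mul (by positivity), ENNReal.ofReal_mul hεs.le, sq]
          ring
      _ ≤ c₃ * (ENNReal.ofReal (ε ^ s) ^ 2 * ENNReal.ofReal (‖x - y‖ ^ (-s))) := by gcongr
      _ = c₃ * ENNReal.ofReal (ε ^ s) ^ 2 * ENNReal.ofReal (‖x - y‖ ^ (-s)) := by ring

/-! ### The dimension theorem from the printed second-moment estimate -/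

/-- **`dim_H γ[0,∞) = 1 + κ/8` a.s. for `0 < κ < 8`, from Beffara's printed second-moment estimate
alone.** The upper bound (`ae_dimH_range_sleTrace_le_of_lt_eight`), the one-point lower estimate
(`exists_onePoint_lower_of_isCompact`, Prop. 4), the 0–1 law (Lemma 3), the second-moment method
(Prop. 1) in the window `B̄(20i, 1)`, the trace (Rohde–Schramm Thm. 5.1) and transience (Thm. 7.1) are
theorems of the tree; `h2` is the last display of Beffara's §3.2 under the standing assumptions of
§3/§3.1, with the window normalisation `Im ≥ 1`.
[cite: Beffara2008, Theorem (Introduction), Prop. 1, Lemma 3, Prop. 4, §3.2] -/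
theorem ae_dimH_range_sleTrace_eq_of_lt_eight_of_secondMoment (hκ0 : 0 < κ) (hκ8 : κ < 8)
    (h2 : ∃ C : ℝ≥0, ∀ z z' : ℂ, 1 ≤ z.im → 1 ≤ z'.im → 9 * ‖z - z'‖ < z.im → 9 * ‖z - z'‖ < z'.im →
      ∀ ε : ℝ, 0 < ε → ε < ‖z - z'‖ / 2 →
        preWienerMeasure {ω | infDist z (range (sleTrace κ ω)) ≤ ε ∧
            infDist z' (range (sleTrace κ ω)) ≤ ε} ≤
          C * ENNReal.ofReal (ε ^ (2 * (1 - (κ : ℝ) / 8)) * (‖z - z'‖ / 2) ^ (-(1 - (κ : ℝ) / 8)))) :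
    ∀ᵐ ω ∂preWienerMeasure, dimH (range (sleTrace κ ω)) = 1 + (κ : ℝ≥0∞) / 8 := by
  have hT : HasSLETrace κ := hasSLETrace_of_ne_eight_apply hκ8.ne
  have htr := tendsto_norm_sleTrace_atTop_of_ne_eight hκ0 hκ8.ne
  -- the lower bound with positive probability, in the window `B̄(20i, 1)` along `εₙ = ε₀/(n+1)`
  have hL : 0 < preWienerMeasure {ω | 1 + (κ : ℝ≥0∞) / 8 ≤ dimH (range (sleTrace κ ω))} := by
    obtain ⟨hKc, hKH, hKv⟩ := window20_props
    obtain ⟨c₁, hc₁, ε₁, hε₁, h1⟩ := exists_onePoint_lower_of_isCompact hκ0 hκ8 hT _ hKc hKH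
    obtain ⟨c₃, hc₃, ε₃, hε₃, h3⟩ := twoPoint_window_of_secondMoment hκ0 hκ8 hT h2
    set ε₀ : ℝ := min ε₁ ε₃ with hε₀
    have hε₀pos : 0 < ε₀ := lt_min hε₁ hε₃
    set ε : ℕ → ℝ := fun n ↦ ε₀ / ((n : ℝ) + 1) with hε
    have hεpos : ∀ n, 0 < ε n := fun n ↦ by rw [hε]; positivity
    have hεle : ∀ n, ε n ≤ ε₀ := fun n ↦ by
      rw [hε]
      exact div_le_self hε₀pos.le (by linarith [(Nat.cast_nonneg n : (0 : ℝ) ≤ n)])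
    have hεanti : Antitone ε := fun m n hmn ↦ by
      simp only [hε]
      exact div_le_div_of_nonneg_left hε₀pos.le (by positivity)
        (by exact_mod_cast Nat.add_le_add_right hmn 1)
    have hεlim : Tendsto ε atTop (𝓝 0) := by
      have h := (tendsto_one_div_add_atTop_nhds_zero_nat (𝕜 := ℝ)).const_mul ε₀
      rw [mul_zero] at h
      refine h.congr fun n ↦ ?_
      simp only [hε]
      ring
    exact measure_dimH_range_sleTrace_ge_pos_of_estimates hT hκ8 htr hKc hKv hεpos hεanti hεlim hc₁ hc₃
      (fun n z hz ↦ h1 (ε n) (hεpos n) ((hεle n).trans (min_le_left _ _)) z hz)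
      (fun n x hx y hy ↦ h3 (ε n) (hεpos n) ((hεle n).trans (min_le_right _ _)) x hx y hy)
  exact ae_dimH_range_sleTrace_eq_of_measure_pos
    (measure_setOf_dimH_eq_pos_of_ae_le (ae_dimH_range_sleTrace_le_of_lt_eight hκ0 hκ8) hL)
    (ae_dimH_range_sleTrace_eq_or_ae_ne hT _)

/-- **`ae_dimH_range_sleTrace` (Beffara's theorem, `0 < κ ≤ 8`) from the SLE₈ trace theorem and
Beffara's printed second-moment estimate.** Inputs: `h8e` — Lawler–Schramm–Werner (2004), Thm. 4.7
(SLE₈ is generated by a continuous transient curve; used only at `κ = 8`, where the fact is equivalent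
to it, `ae_dimH_range_sleTrace_eight_iff_hasSLETrace_eight`); `h2` — for each `0 < κ < 8`, the last
display of Beffara (2008), §3.2 (equivalently Lawler–Werness (2013), §4 Thm. 2) in its printed regime.
Everything else in Beffara's proof is a theorem of the tree.
[cite: Beffara2008, Theorem (Introduction) and §3.2; LawlerSchrammWerner2004, Thm 4.7] -/
theorem ae_dimH_range_sleTrace_of_hasSLETrace_eight_of_secondMoment (h8e : hasSLETrace_eight)
    (h2 : ∀ {κ : ℝ≥0}, 0 < κ → κ < 8 → ∃ C : ℝ≥0, ∀ z z' : ℂ, 1 ≤ z.im → 1 ≤ z'.im →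
      9 * ‖z - z'‖ < z.im → 9 * ‖z - z'‖ < z'.im → ∀ ε : ℝ, 0 < ε → ε < ‖z - z'‖ / 2 →
        preWienerMeasure {ω | infDist z (range (sleTrace κ ω)) ≤ ε ∧
            infDist z' (range (sleTrace κ ω)) ≤ ε} ≤
          C * ENNReal.ofReal (ε ^ (2 * (1 - (κ : ℝ) / 8)) * (‖z - z'‖ / 2) ^ (-(1 - (κ : ℝ) / 8))))
    {κ : ℝ≥0} : ae_dimH_range_sleTrace (κ := κ) := by
  intro hκ0 hκ8
  rcases hκ8.lt_or_eq with hlt | rfl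
  · exact ae_dimH_range_sleTrace_eq_of_lt_eight_of_secondMoment hκ0 hlt (h2 hκ0 hlt)
  · exact ae_dimH_range_sleTrace_eight_of_hasSLETrace_eight h8e hκ0 hκ8

end Literature.Probability.RandomPlanarGeometry

end
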